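import Literature.NumberTheory.Automorphic.UnitaryGroupArthurKernelClassExpansion
import Literature.NumberTheory.Automorphic.UnitaryGroupCharpolyClassFinite
import Literature.NumberTheory.Automorphic.UnitaryGroupCharpolyBorelClasses
import Literature.NumberTheory.Automorphic.UnitaryGroupRationalIsotropicLastRow
import Literature.NumberTheory.Automorphic.UnitaryGroupTruncationFiniteSum
import HarnessLib

/-!
# Regular hyperbolic classes of `U(J₃)` live in rational Borels: an isotropic rational eigenline
# conjugates a rational element into `B(F)`
(Arthur, *A trace formula for reductive groups I*, Duke Math. J. 45 (1978), §8; Rogawski, *Automorphic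
Representations of Unitary Groups in Three Variables* (1990), §1.10, §2.2–§2.3 and §14.5 p. 237 — for
the transfer `f` of a test function on the anisotropic inner form the regular hyperbolic terms drop out)

Topic `NumberTheory/Automorphic`; namespace `Literature.NumberTheory.Automorphic.UnitaryGroup`.
Proof file: THEOREMS ONLY over accepted tree modules (no definition, no named fact, no instance, no
notation, no `sorry`). Setting: the quasi-split unitary group `U(J_N)` ∕ `U(J₃)` (★ `quasiSplit F E c N`),
`B(𝔸_F) =` ★ `borelAdelic`, `B(F) =` ★ `arithmeticBorel`, `N(𝔸_F) =` ★ `adelicUnipotent`; an ABSTRACT class map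
`cl : G(F) → ι` with ★ `IsConjInvariant cl`; the class objects ★ `kernelClass` (`K_𝔬`), ★ `borelSumClass`,
★ `kernelBorelClass` (`K_{B,𝔬}`), ★ `kernelBorelTailClass`, ★ `truncatedKernelClass` (`k^T_𝔬`),
★ `truncatedTraceClass` (`J^T_𝔬`).

THE POINT (LAW 5 (ii) of the T1-qs road, first letters; RULING #114b of the cell). After LAW 4 (the
classes MISSING `B(F)` are orbital integrals) the remaining classes of the `𝔬`-expansion MEET the
rational Borel; among them the REGULAR HYPERBOLIC classes (characteristic polynomial with a root `α ∈ E`,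
`α · c α ≠ 1`: Rogawski's `d(α, β, ᾱ⁻¹)` with `αᾱ ≠ 1`) consist ENTIRELY of elements `G(F)`-conjugate into
`B(F)`: **a rational element of `U(J₃)` with an isotropic rational left eigenvector is `G(F)`-conjugate
into `B(F)`** (Witt ★ `exists_rational_lastRow_eq_smul` + ★ `mem_borelAdelic_toAdelic_of_lastRow_eq_smul`;
Rogawski §1.10: `B` = stabiliser of an isotropic line), and **an eigenvalue `α` with `α · c α ≠ 1` has an
isotropic left eigenvector** (unitarity on row vectors, ★ `coe_inv_apply_of_mem_unitaryGroupOfForm_antidiagonal`: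
`⟨ξγ, ξγ⟩ = α c(α) ⟨ξ, ξ⟩`). This is the structural input of the weighted-orbital-integral evaluation
`P_𝔬(log T) = vol · [2 log T · Φ_T(γ, f) + J^v_T(γ, f)]` of these classes [Arthur 1978 §8], typed in a
sequel; here only the conjugation into the Borel.

* `sum_vecMul_mul_conj_vecMul_rev` (unitarity on row vectors), **`exists_isotropic_vecMul_eq_smul_of_isRoot`**,
  **`exists_conj_mem_arithmeticBorel_of_vecMul_eq_smul`**, **`forall_exists_conj_mem_arithmeticBorel_of_charpoly_eq`**,
  `forall_exists_conj_mem_arithmeticBorel_of_hyperbolic` (the letters of case (iii) of ★ `meetsBorel_trichotomy`).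

## References

* J. Arthur, *A trace formula for reductive groups I*, Duke Math. J. 45 (1978), §8 — cited through the
  held expositions below.
* J. D. Rogawski, *Automorphic Representations of Unitary Groups in Three Variables*, Ann. of Math.
  Studies 123 (1990), §1.10 (Witt, Borel = stabiliser of an isotropic line), §2.2–§2.3 (pp. 12–14),
  §14.5 (p. 237) [Rogawski1990].
* S. Shokranian, *The Selberg–Arthur Trace Formula*, LNM 1503 (1992), §5.2 [Shokranian1992].
-/

set_option autoImplicit false

noncomputable section

open MeasureTheory Measure NumberField IsDedekindDomain Set Matrix Polynomial
open scoped NNReal ENNReal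

namespace Literature.NumberTheory.Automorphic

namespace UnitaryGroup

variable {F E : Type} [Field F] [NumberField F] [Field E] [NumberField E] [Algebra F E]
  {c : E ≃ₐ[F] E} {N : ℕ} {ι : Type*}

/-! ## §1 `U(J₃)`: regular hyperbolic classes live in rational Borels -/

section Three

/-- **Unitarity on row vectors**: for `γ ∈ U(J₃)(F)` and rows `ξ, η ∈ E³`,
`Σ_i (ξγ)_i · c((ηγ)_{rev i}) = Σ_i ξ_i · c(η_{rev i})` — the hermitian pairing of `J₃` is preserved
(from `γ γ⁻¹ = 1` and ★ `coe_inv_apply_of_mem_unitaryGroupOfForm_antidiagonal`: `(γ⁻¹)_{ij} = c(γ_{rev j, rev i})`).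
[cite: Rogawski1990, §1.9–§1.10] -/
theorem sum_vecMul_mul_conj_vecMul_rev (γ : (quasiSplit F E c 3).Rational) (ξ η : Fin 3 → E) :
    ∑ i, (ξ ᵥ* ((γ.1 : GL (Fin 3) E) : Matrix (Fin 3) (Fin 3) E)) i *
        c ((η ᵥ* ((γ.1 : GL (Fin 3) E) : Matrix (Fin 3) (Fin 3) E)) (Fin.rev i)) =
      ∑ i, ξ i * c (η (Fin.rev i)) := by
  set A : Matrix (Fin 3) (Fin 3) E := ((γ.1 : GL (Fin 3) E) : Matrix (Fin 3) (Fin 3) E) with hA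
  set Ai : Matrix (Fin 3) (Fin 3) E := (((γ.1 : GL (Fin 3) E)⁻¹ : GL (Fin 3) E) : Matrix (Fin 3) (Fin 3) E)
    with hAi
  have hinv : ∀ i j : Fin 3, Ai i j = c (A (Fin.rev j) (Fin.rev i)) := fun i j =>
    coe_inv_apply_of_mem_unitaryGroupOfForm_antidiagonal (c : E →+* E) 3 γ.2 i j
  have hmul : A * Ai = 1 := by
    rw [hA, hAi, ← Units.val_mul, mul_inv_cancel, Units.val_one]
  -- `Σ_i A_{ki} c(A_{l, rev i}) = (A A⁻¹)_{k, rev l} = [k = rev l]`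
  have key : ∀ k l : Fin 3, ∑ i, A k i * c (A l (Fin.rev i)) = if k = Fin.rev l then 1 else 0 := by
    intro k l
    have h := congrFun (congrFun hmul k) (Fin.rev l)
    rw [Matrix.mul_apply, Matrix.one_apply] at h
    rw [← h]
    refine Finset.sum_congr rfl fun i _ => ?_
    rw [hinv, Fin.rev_rev]
  -- the reindexed right-hand side
  have hrhs : ∑ i, ξ i * c (η (Fin.rev i)) = ∑ l, ξ (Fin.rev l) * c (η l) := by
    rw [← Equiv.sum_comp Fin.revPerm (fun i => ξ i * c (η (Fin.rev i)))]
    refine Finset.sum_congr rfl fun l _ => ?_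
    simp only [Fin.revPerm_apply, Fin.rev_rev]
  rw [hrhs]
  calc ∑ i, (ξ ᵥ* A) i * c ((η ᵥ* A) (Fin.rev i))
      = ∑ i, ∑ k, ∑ l, ξ k * A k i * (c (η l) * c (A l (Fin.rev i))) := by
        refine Finset.sum_congr rfl fun i _ => ?_
        rw [Matrix.vecMul, Matrix.vecMul, dotProduct, dotProduct, _root_.map_sum, Finset.sum_mul_sum]
        refine Finset.sum_congr rfl fun k _ => Finset.sum_congr rfl fun l _ => ?_
        rw [map_mul]
    _ = ∑ k, ∑ l, ξ k * c (η l) * ∑ i, A k i * c (A l (Fin.rev i)) := by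
        rw [Finset.sum_comm]
        refine Finset.sum_congr rfl fun k _ => ?_
        rw [Finset.sum_comm]
        refine Finset.sum_congr rfl fun l _ => ?_
        rw [Finset.mul_sum]
        refine Finset.sum_congr rfl fun i _ => ?_
        ring
    _ = ∑ k, ∑ l, ξ k * c (η l) * (if k = Fin.rev l then 1 else 0) := by
        simp_rw [key]
    _ = ∑ l, ∑ k, ξ k * c (η l) * (if k = Fin.rev l then 1 else 0) := Finset.sum_comm
    _ = ∑ l, ξ (Fin.rev l) * c (η l) := by
        refine Finset.sum_congr rfl fun l _ => ?_
        simp_rw [mul_ite, mul_one, mul_zero]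
        rw [Finset.sum_ite_eq' Finset.univ (Fin.rev l)]
        simp only [Finset.mem_univ, if_true]

/-- **An eigenvalue `α` with `α · c α ≠ 1` of `γ ∈ U(J₃)(F)` has an ISOTROPIC left eigenvector**: a root
`α ∈ E` of the characteristic polynomial gives `ξ ≠ 0` with `ξ γ = α ξ` (Mathlib
`Matrix.exists_vecMul_eq_zero_iff`, `Matrix.eval_charpoly`), and unitarity gives
`⟨ξ, ξ⟩ = ⟨ξγ, ξγ⟩ = α c(α) ⟨ξ, ξ⟩`, so `⟨ξ, ξ⟩ = 0`. (The regular HYPERBOLIC elements: the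
eigenvalue off the norm-one torus.) [cite: Rogawski1990, §1.10] -/
theorem exists_isotropic_vecMul_eq_smul_of_isRoot (γ : (quasiSplit F E c 3).Rational) {α : E}
    (hα : ((γ.1 : GL (Fin 3) E) : Matrix (Fin 3) (Fin 3) E).charpoly.IsRoot α) (hreg : α * c α ≠ 1) :
    ∃ ξ : Fin 3 → E, ξ ≠ 0 ∧ (∑ i, ξ i * c (ξ (Fin.rev i)) = 0) ∧
      ξ ᵥ* ((γ.1 : GL (Fin 3) E) : Matrix (Fin 3) (Fin 3) E) = α • ξ := by
  set A : Matrix (Fin 3) (Fin 3) E := ((γ.1 : GL (Fin 3) E) : Matrix (Fin 3) (Fin 3) E) with hA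
  -- a left eigenvector for the root `α`
  have hdet : (Matrix.scalar (Fin 3) α - A).det = 0 := by
    rw [← Matrix.eval_charpoly]; exact hα
  obtain ⟨ξ, hξ, hξ0⟩ := Matrix.exists_vecMul_eq_zero_iff.2 hdet
  have heig : ξ ᵥ* A = α • ξ := by
    have h : ξ ᵥ* (Matrix.scalar (Fin 3) α) - ξ ᵥ* A = 0 := by rw [← Matrix.vecMul_sub, hξ0]
    rw [sub_eq_zero] at h
    rw [← h]
    funext i
    rw [Matrix.scalar_apply, Matrix.vecMul_diagonal, Pi.smul_apply, smul_eq_mul, mul_comm]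
  refine ⟨ξ, hξ, ?_, heig⟩
  -- isotropy from unitarity
  have hu := sum_vecMul_mul_conj_vecMul_rev γ ξ ξ
  rw [heig] at hu
  have h2 : α * c α * ∑ i, ξ i * c (ξ (Fin.rev i)) = ∑ i, ξ i * c (ξ (Fin.rev i)) := by
    conv_rhs => rw [← hu]
    rw [Finset.mul_sum]
    refine Finset.sum_congr rfl fun i _ => ?_
    simp only [Pi.smul_apply, smul_eq_mul, map_mul]
    ring
  have h3 : (α * c α - 1) * ∑ i, ξ i * c (ξ (Fin.rev i)) = 0 := by
    rw [sub_mul, one_mul, h2, sub_self]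
  rcases mul_eq_zero.1 h3 with h | h
  · exact absurd (sub_eq_zero.1 h) hreg
  · exact h

/-- **A rational element with an isotropic rational left eigenvector is `G(F)`-conjugate into `B(F)`**:
Witt (★ `exists_rational_lastRow_eq_smul`) carries the isotropic line to `E · e₃` by some `δ ∈ U(J₃)(F)`,
and then the last row of `δ γ δ⁻¹` is `μ e₃`, i.e. `δ γ δ⁻¹` stabilises the standard isotropic line,
i.e. lies in the Borel subgroup (★ `mem_borelAdelic_toAdelic_of_lastRow_eq_smul`; Rogawski (1990), §1.10:
`B` = stabiliser of an isotropic line). [cite: Rogawski1990, §1.10] -/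
theorem exists_conj_mem_arithmeticBorel_of_vecMul_eq_smul (hc : c * c = 1)
    (γ : (quasiSplit F E c 3).Rational) {ξ : Fin 3 → E} (hξ : ξ ≠ 0)
    (hiso : ∑ i, ξ i * c (ξ (Fin.rev i)) = 0) {μ : E}
    (heig : ξ ᵥ* ((γ.1 : GL (Fin 3) E) : Matrix (Fin 3) (Fin 3) E) = μ • ξ) :
    ∃ δ : (quasiSplit F E c 3).Rational,
      (quasiSplit F E c 3).toAdelic (δ * γ * δ⁻¹) ∈ borelAdelic F E c 3 := by
  obtain ⟨δ, a, ha, hrow⟩ := exists_rational_lastRow_eq_smul (F := F) hc hξ hiso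
  refine ⟨δ, mem_borelAdelic_toAdelic_of_lastRow_eq_smul (a := μ) ?_⟩
  -- the last row of `δ γ δ⁻¹` is `e₃ δ γ δ⁻¹ = a ξ γ δ⁻¹ = μ a ξ δ⁻¹ = μ e₃ δ δ⁻¹ = μ e₃`
  set D : Matrix (Fin 3) (Fin 3) E := ((δ.1 : GL (Fin 3) E) : Matrix (Fin 3) (Fin 3) E) with hD
  set Di : Matrix (Fin 3) (Fin 3) E := (((δ.1 : GL (Fin 3) E)⁻¹ : GL (Fin 3) E) : Matrix (Fin 3) (Fin 3) E)
    with hDi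
  set A : Matrix (Fin 3) (Fin 3) E := ((γ.1 : GL (Fin 3) E) : Matrix (Fin 3) (Fin 3) E) with hA
  have hrow' : D ⊤ = a • ξ := hrow
  have h1 : ((δ * γ * δ⁻¹ : (quasiSplit F E c 3).Rational).1 : GL (Fin 3) E) =
      (δ.1 : GL (Fin 3) E) * (γ.1 : GL (Fin 3) E) * (δ.1 : GL (Fin 3) E)⁻¹ := rfl
  have hprod : (((δ * γ * δ⁻¹ : (quasiSplit F E c 3).Rational).1 : GL (Fin 3) E) :
      Matrix (Fin 3) (Fin 3) E) = D * A * Di := by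
    rw [h1, Units.val_mul, Units.val_mul]
  have hDDi : D * Di = 1 := by
    rw [hD, hDi, ← Units.val_mul, mul_inv_cancel, Units.val_one]
  -- row `⊤` of a product is the `vecMul` of row `⊤` (definitional)
  have hrowmul : ∀ M P : Matrix (Fin 3) (Fin 3) E, (M * P) ⊤ = M ⊤ ᵥ* P := fun M P => rfl
  change (((δ * γ * δ⁻¹ : (quasiSplit F E c 3).Rational).1 : GL (Fin 3) E) :
      Matrix (Fin 3) (Fin 3) E) ⊤ = μ • Pi.single (⊤ : Fin 3) (1 : E)
  rw [hprod, hrowmul, hrowmul, hrow', Matrix.smul_vecMul, heig, smul_smul, mul_comm a μ, ← smul_smul,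
    ← hrow', Matrix.smul_vecMul, ← hrowmul, hDDi]
  funext j
  rw [Pi.smul_apply, Pi.smul_apply, Matrix.one_eq_pi_single]

/-- **REGULAR HYPERBOLIC CLASSES LIVE IN RATIONAL BORELS** (in the letters of the characteristic-polynomial
class map of ★ `UnitaryGroupCharpolyClassMap`): if `p ∈ E[X]` has a root `α ∈ E` with `α · c α ≠ 1`, then
EVERY `γ ∈ G(F)` whose adelic characteristic polynomial is `p ⊗ 𝔸_E` is `G(F)`-conjugate into `B(F)` — the
hypothesis `hB` of §1 for the class of `p`. [cite: Rogawski1990, §1.10] [cite: Rogawski1990, §2.3 (p. 14)] -/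
theorem forall_exists_conj_mem_arithmeticBorel_of_charpoly_eq (hc : c * c = 1) {p : Polynomial E} {α : E}
    (hα : p.IsRoot α) (hreg : α * c α ≠ 1) :
    ∀ γ : (quasiSplit F E c 3).arithmeticSubgroup,
      ((adelicVal F E c 3 _ (γ : (quasiSplit F E c 3).Adelic) : GL (Fin 3) (AdeleRing (𝓞 E) E)) :
          Matrix (Fin 3) (Fin 3) (AdeleRing (𝓞 E) E)).charpoly = p.map (algebraMap E (AdeleRing (𝓞 E) E)) →
        ∃ δ : (quasiSplit F E c 3).arithmeticSubgroup, δ * γ * δ⁻¹ ∈ arithmeticBorel F E c 3 := by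
  intro γ hγ
  obtain ⟨γ₀, hγ₀⟩ := MonoidHom.mem_range.mp γ.2
  -- the rational characteristic polynomial of `γ₀` is `p`
  have hp : ((γ₀.1 : GL (Fin 3) E) : Matrix (Fin 3) (Fin 3) E).charpoly = p := by
    apply Polynomial.map_injective _ (AdeleRing.algebraMap_injective (𝓞 E) E)
    rw [← charpoly_adelicVal_toAdelic, hγ₀]
    exact hγ
  obtain ⟨ξ, hξ, hiso, heig⟩ := exists_isotropic_vecMul_eq_smul_of_isRoot γ₀ (hp ▸ hα) hreg
  obtain ⟨δ, hδ⟩ := exists_conj_mem_arithmeticBorel_of_vecMul_eq_smul hc γ₀ hξ hiso heig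
  refine ⟨⟨(quasiSplit F E c 3).toAdelic δ, ⟨δ, rfl⟩⟩, ?_⟩
  rw [mem_arithmeticBorel_iff]
  have h : ((⟨(quasiSplit F E c 3).toAdelic δ, ⟨δ, rfl⟩⟩ * γ *
      ⟨(quasiSplit F E c 3).toAdelic δ, ⟨δ, rfl⟩⟩⁻¹ : (quasiSplit F E c 3).arithmeticSubgroup) :
        (quasiSplit F E c 3).Adelic) = (quasiSplit F E c 3).toAdelic (δ * γ₀ * δ⁻¹) := by
    rw [map_mul, map_mul, map_inv, hγ₀]
    rfl
  rw [h]
  exact hδ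

/-- The same in the letters of the REGULAR HYPERBOLIC case (iii) of ★ `meetsBorel_trichotomy`
(`UnitaryGroupCharpolyBorelClasses`): for `a ∈ Eˣ` with `c a · a ≠ 1` and any `b`, every `γ ∈ G(F)` in the
class `((X − a)(X − b)(X − (c a)⁻¹)) ⊗ 𝔸_E` is `G(F)`-conjugate into `B(F)`.
[cite: Rogawski1990, §1.10] [cite: Rogawski1990, §3.6 (p. 27)] -/
theorem forall_exists_conj_mem_arithmeticBorel_of_hyperbolic (hc : c * c = 1) {a : Eˣ} (b : Eˣ)
    (ha : c (a : E) * (a : E) ≠ 1) :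
    ∀ γ : (quasiSplit F E c 3).arithmeticSubgroup,
      ((adelicVal F E c 3 _ (γ : (quasiSplit F E c 3).Adelic) : GL (Fin 3) (AdeleRing (𝓞 E) E)) :
          Matrix (Fin 3) (Fin 3) (AdeleRing (𝓞 E) E)).charpoly =
        ((X - C (a : E)) * (X - C (b : E)) * (X - C (c (a : E))⁻¹)).map (algebraMap E (AdeleRing (𝓞 E) E)) →
        ∃ δ : (quasiSplit F E c 3).arithmeticSubgroup, δ * γ * δ⁻¹ ∈ arithmeticBorel F E c 3 :=
  forall_exists_conj_mem_arithmeticBorel_of_charpoly_eq hc (α := (a : E))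
    (by simp only [Polynomial.IsRoot.def, Polynomial.eval_mul, Polynomial.eval_sub, Polynomial.eval_X,
      Polynomial.eval_C, sub_self, zero_mul])
    (by rwa [mul_comm] at ha)

end Three

end UnitaryGroup

end Literature.NumberTheory.Automorphic

end
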